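import Mathlib
import Literature.Analysis.FluidPDE.SelfSimilar
import Literature.Analysis.FluidPDE.SuitableWeak
import Literature.Analysis.FluidPDE.SpaceTimeRescaling

/-!
# Type II blow-up, Fatou half: the CKN-scaled `L^q` norms diverge for `q ≥ 3`

Helper file for crux `LandauTailBlowup` (stmt-NavierStokesRegularity-1944), line `registered`,
registered stub `landauTail_scaledNorm_tendsto_top_of_three_le` ("Fatou half of the Type-II
theorem"): if a field `u : ℝ → ℝ³ → ℝ³`, jointly continuous on `(-1, 0) × ℝ³`, has a pointwise
parabolic tail `√(-t) u(t, √(-t) y) → U y` (`t → 0⁻`, `y ≠ 0`) to a nonzero `(-1)`-homogeneous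
profile `U` continuous off the origin, then for every real `q ≥ 3` the Caffarelli–Kohn–Nirenberg
scaled space–time norms `r^{q-5} ∫∫_{Q_r(0,0)} |u|^q` tend to `∞` as `r → 0⁺`.

The proof is Fatou's lemma along the Navier–Stokes rescalings `u_r = nsRescale r u`:
* `landauTail_scaled_lintegral_eq_nsRescale`: `r^{q-5} ∫∫_{Q_r} |u|^q = ∫∫_{Q_1} |u_r|^q`
  (parabolic change of variables);
* `landauTail_nsRescale_tendsto_profile`: `u_r(τ, y) → U y` as `r → 0⁺` (`τ < 0`, `y ≠ 0`);
* `landauTail_lintegral_profile_rpow_eq_top`: `∫_{B_1} |U|^q = ∞` for `q ≥ 3` (the profile grows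
  like `|x|⁻¹` along a ray, so the integrals over the disjoint dyadic copies of a small ball do
  not decay);
* `landauTail_scaledNorm_tendsto_top_of_three_le`: Fatou.
-/

set_option linter.dupNamespace false

namespace Summit.NavierStokesRegularity.NavierStokesRegularity.Theorems

open MeasureTheory Set Filter Topology Metric Literature.Analysis.FluidPDE
open scoped ENNReal NNReal

/-- **Rescaling identity for the parabolic cylinder** [folklore; Caffarelli–Kohn–Nirenberg
scaling]: for `r > 0` and `q > 0`,
`r^{q-5} ∫∫_{Q_r(0,0)} ‖u‖^q = ∫∫_{Q_1(0,0)} ‖u_r‖^q` with `u_r(τ, y) = r u(r² τ, r y)` the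
Navier–Stokes rescaling (`(τ, y) ↦ (r² τ, r y)` maps `Q_1` onto `Q_r` with Jacobian `r⁵`). -/
theorem landauTail_scaled_lintegral_eq_nsRescale : ∀ (u : ℝ → EuclideanSpace ℝ (Fin 3) → EuclideanSpace ℝ (Fin 3)) (q : ℝ), 0 < q → ∀ r : ℝ, 0 < r → ENNReal.ofReal (r ^ (q - 5)) * ∫⁻ z in Literature.Analysis.FluidPDE.parabolicCylinder r ((0 : ℝ), (0 : EuclideanSpace ℝ (Fin 3))), ‖u z.1 z.2‖ₑ ^ q = ∫⁻ z in Literature.Analysis.FluidPDE.parabolicCylinder 1 ((0 : ℝ), (0 : EuclideanSpace ℝ (Fin 3))), ‖Literature.Analysis.FluidPDE.nsRescale r u z.1 z.2‖ₑ ^ q := by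
  intro u q hq r hr
  have hpre : stAffine (r ^ 2) r 0 (0 : EuclideanSpace ℝ (Fin 3)) ⁻¹'
      parabolicCylinder r ((0 : ℝ), (0 : EuclideanSpace ℝ (Fin 3))) =
      parabolicCylinder 1 ((0 : ℝ), (0 : EuclideanSpace ℝ (Fin 3))) := by
    have h := stAffine_preimage_cylinder_eq_parabolicCylinder
      (E := EuclideanSpace ℝ (Fin 3)) one_pos hr 0 0 r
    rw [div_one, div_self hr.ne'] at h
    exact h
  have key := setLIntegral_enorm_rpow_stRescale (pow_pos hr 2) hr 0
    (0 : EuclideanSpace ℝ (Fin 3)) r u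
    (parabolicCylinder r ((0 : ℝ), (0 : EuclideanSpace ℝ (Fin 3)))) hq.le
  rw [hpre] at key
  have hint : (fun z : ℝ × EuclideanSpace ℝ (Fin 3) => ‖nsRescale r u z.1 z.2‖ₑ ^ q) =
      fun z => ‖(r • stPull (r ^ 2) r 0 0 u) z.1 z.2‖ₑ ^ q := by
    funext z
    simp only [nsRescale_apply, Pi.smul_apply, stPull_apply, zero_add]
  rw [hint, key, finrank_euclideanSpace_fin, Real.enorm_eq_ofReal hr.le,
    ENNReal.ofReal_rpow_of_pos hr, ← ENNReal.ofReal_mul (by positivity)]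
  congr 2
  rw [Real.rpow_sub hr, show (5 : ℝ) = ((5 : ℕ) : ℝ) by norm_num, Real.rpow_natCast]
  field_simp

/-- **Pointwise limit of the Navier–Stokes rescalings** [folklore]: if `U` is
`(-1)`-homogeneous and `√(0 - t) • u t (√(0 - t) • y) → U y` as `t → 0⁻` for every `y ≠ 0`,
then for every `τ < 0` and `y ≠ 0` the rescalings `u_r(τ, y) = r • u (r² τ) (r • y)` converge
to `U y` as `r → 0⁺` (substitute `t = r² τ`, `y' = y / √(-τ)` and use homogeneity). -/
theorem landauTail_nsRescale_tendsto_profile : ∀ (u : ℝ → EuclideanSpace ℝ (Fin 3) → EuclideanSpace ℝ (Fin 3)) (U : EuclideanSpace ℝ (Fin 3) → EuclideanSpace ℝ (Fin 3)), (∀ c : ℝ, 0 < c → ∀ x : EuclideanSpace ℝ (Fin 3), U (c • x) = c⁻¹ • U x) → (∀ y : EuclideanSpace ℝ (Fin 3), y ≠ 0 → Filter.Tendsto (fun t : ℝ => Real.sqrt (0 - t) • u t (Real.sqrt (0 - t) • y)) (nhdsWithin 0 (Set.Iio 0)) (nhds (U y))) → ∀ τ : ℝ, τ < 0 → ∀ y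 : EuclideanSpace ℝ (Fin 3), y ≠ 0 → Filter.Tendsto (fun r : ℝ => Literature.Analysis.FluidPDE.nsRescale r u τ y) (nhdsWithin 0 (Set.Ioi 0)) (nhds (U y)) := by
  intro u U hhom htail τ hτ y hy
  set s : ℝ := Real.sqrt (0 - τ) with hs_def
  have hs : 0 < s := Real.sqrt_pos.2 (by linarith)
  have hy' : s⁻¹ • y ≠ 0 := smul_ne_zero (inv_ne_zero hs.ne') hy
  have htime : Tendsto (fun r : ℝ => r ^ 2 * τ) (𝓝[>] 0) (𝓝[<] 0) := by
    refine tendsto_nhdsWithin_iff.2 ⟨?_, ?_⟩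
    · have h : Tendsto (fun r : ℝ => r ^ 2 * τ) (𝓝 0) (𝓝 (0 ^ 2 * τ)) :=
        ((continuous_pow 2).mul continuous_const).tendsto 0
      rw [zero_pow two_ne_zero, zero_mul] at h
      exact h.mono_left nhdsWithin_le_nhds
    · filter_upwards [self_mem_nhdsWithin] with r hr
      exact mul_neg_of_pos_of_neg (pow_pos hr 2) hτ
  have h1 := ((htail (s⁻¹ • y) hy').comp htime).const_smul s⁻¹
  rw [hhom _ (inv_pos.2 hs), inv_inv, smul_smul, inv_mul_cancel₀ hs.ne', one_smul] at h1
  refine h1.congr' ?_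
  filter_upwards [self_mem_nhdsWithin] with r hr
  have hr' : 0 < r := hr
  have hsq : Real.sqrt (0 - r ^ 2 * τ) = r * s := by
    rw [show (0 : ℝ) - r ^ 2 * τ = r ^ 2 * (0 - τ) by ring, Real.sqrt_mul (sq_nonneg r),
      Real.sqrt_sq hr'.le]
  simp only [Function.comp_apply, hsq, nsRescale_apply, smul_smul]
  rw [show s⁻¹ * (r * s) = r by field_simp, show r * s * s⁻¹ = r by field_simp]

/-- **The profile is not in `L^q(B_1)` for `q ≥ 3`** [folklore]: a `(-1)`-homogeneous field
`U : ℝ³ → ℝ³`, continuous off the origin and not identically zero, has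
`∫_{B_1(0)} ‖U‖^q = ∞` for every real `q ≥ 3`.  Proof without polar coordinates: `U` is bounded
below by `m > 0` on a small ball `B(x₁, δ')` with `‖x₁‖ = 1/2`; its dyadic copies
`2^{-k} B(x₁, δ')` are pairwise disjoint, lie in `B_1(0)`, and on the `k`-th copy
`‖U‖ ≥ 2^k m` (homogeneity), so each copy contributes at least `(2^k m)^q (2^{-k} δ')³ |B_1| ≥
m^q δ'³ |B_1|` to the integral. -/
theorem landauTail_lintegral_profile_rpow_eq_top : ∀ (U : EuclideanSpace ℝ (Fin 3) → EuclideanSpace ℝ (Fin 3)), ContinuousOn U {0}ᶜ → (∀ c : ℝ, 0 < c → ∀ x : EuclideanSpace ℝ (Fin 3), U (c • x) = c⁻¹ • U x) → (∃ x : EuclideanSpace ℝ (Fin 3), U x ≠ 0) → ∀ q : ℝ, 3 ≤ q → ∫⁻ x in Metric.ball (0 : EuclideanSpace ℝ (Fin 3)) 1, ‖U x‖ₑ ^ q = ⊤ := by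
  intro U hU hhom hne q hq
  obtain ⟨x₀, hx₀⟩ := hne
  have hq0 : 0 ≤ q := by linarith
  -- `U 0 = 0`, hence `x₀ ≠ 0`
  have hU0 : U 0 = 0 := by
    have h := hhom 2 two_pos 0
    rw [smul_zero] at h
    have h2 : (1 - (2 : ℝ)⁻¹) • U 0 = 0 := by rw [sub_smul, one_smul, ← h, sub_self]
    rw [smul_eq_zero] at h2
    exact h2.resolve_left (by norm_num)
  have hx₀ne : x₀ ≠ 0 := by
    rintro rfl
    exact hx₀ hU0
  have hnx₀ : 0 < ‖x₀‖ := norm_pos_iff.2 hx₀ne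
  -- normalise the witness to norm `1/2`
  set c₀ : ℝ := 2⁻¹ * ‖x₀‖⁻¹ with hc₀_def
  have hc₀ : 0 < c₀ := by positivity
  set x₁ : EuclideanSpace ℝ (Fin 3) := c₀ • x₀ with hx₁_def
  have hx₁n : ‖x₁‖ = 2⁻¹ := by
    rw [hx₁_def, norm_smul, Real.norm_of_nonneg hc₀.le, hc₀_def, mul_assoc,
      inv_mul_cancel₀ hnx₀.ne', mul_one]
  have hUx₁ : U x₁ ≠ 0 := by
    rw [hx₁_def, hhom c₀ hc₀]
    exact smul_ne_zero (inv_ne_zero hc₀.ne') hx₀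
  have hx₁ne : x₁ ≠ 0 := by
    rw [← norm_ne_zero_iff, hx₁n]
    norm_num
  -- a lower bound `m` for `‖U‖` near `x₁`
  set m : ℝ := ‖U x₁‖ / 2 with hm_def
  have hm : 0 < m := by
    have := norm_pos_iff.2 hUx₁
    positivity
  obtain ⟨δ, hδ, hδU⟩ := Metric.continuousAt_iff.1
    (hU.continuousAt (isOpen_compl_singleton.mem_nhds hx₁ne)) m hm
  have hlow : ∀ x, dist x x₁ < δ → m ≤ ‖U x‖ := by
    intro x hx
    have h1 := hδU hx
    rw [dist_eq_norm] at h1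
    have h2 := norm_sub_norm_le (U x₁) (U x)
    rw [norm_sub_rev] at h2
    linarith
  set δ' : ℝ := min δ 6⁻¹
  have hδ' : 0 < δ' := lt_min hδ (by norm_num)
  have hδ'δ : δ' ≤ δ := min_le_left _ _
  have hδ'6 : δ' ≤ 6⁻¹ := min_le_right _ _
  -- the dyadic copies of `ball x₁ δ'`
  have hak : ∀ k : ℕ, (1 : ℝ) ≤ 2 ^ k := fun k => one_le_pow₀ (by norm_num)
  have hak0 : ∀ k : ℕ, (0 : ℝ) < 2 ^ k := fun k => pow_pos two_pos k
  set B : ℕ → Set (EuclideanSpace ℝ (Fin 3)) :=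
    fun k => ball (((2 : ℝ) ^ k)⁻¹ • x₁) (((2 : ℝ) ^ k)⁻¹ * δ') with hB_def
  have hnorm : ∀ k, ∀ x ∈ B k,
      ((2 : ℝ) ^ k)⁻¹ * 3⁻¹ < ‖x‖ ∧ ‖x‖ < ((2 : ℝ) ^ k)⁻¹ * (2 / 3) := by
    intro k x hx
    simp only [hB_def, mem_ball, dist_eq_norm] at hx
    have ha : 0 ≤ ((2 : ℝ) ^ k)⁻¹ := inv_nonneg.2 (hak0 k).le
    have e : ‖((2 : ℝ) ^ k)⁻¹ • x₁‖ = ((2 : ℝ) ^ k)⁻¹ * 2⁻¹ := by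
      rw [norm_smul, Real.norm_of_nonneg ha, hx₁n]
    have habs := abs_norm_sub_norm_le x (((2 : ℝ) ^ k)⁻¹ • x₁)
    rw [abs_le, e] at habs
    have hδa : ((2 : ℝ) ^ k)⁻¹ * δ' ≤ ((2 : ℝ) ^ k)⁻¹ * 6⁻¹ :=
      mul_le_mul_of_nonneg_left hδ'6 ha
    constructor <;> linarith [habs.1, habs.2]
  have hsub : ∀ k, B k ⊆ ball 0 1 := by
    intro k x hx
    rw [mem_ball_zero_iff]
    have h := (hnorm k x hx).2
    have : ((2 : ℝ) ^ k)⁻¹ ≤ 1 := inv_le_one_of_one_le₀ (hak k)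
    linarith
  have hdisj : Pairwise (Function.onFun Disjoint B) := by
    have key : ∀ j k : ℕ, j < k → Disjoint (B j) (B k) := by
      intro j k hjk
      rw [Set.disjoint_left]
      intro x hxj hxk
      have h1 := (hnorm j x hxj).1
      have h2 := (hnorm k x hxk).2
      have h3 : ((2 : ℝ) ^ k)⁻¹ ≤ ((2 : ℝ) ^ j)⁻¹ * 2⁻¹ := by
        rw [← mul_inv, ← pow_succ]
        exact inv_anti₀ (hak0 _) (pow_le_pow_right₀ one_le_two hjk)
      linarith
    intro j k hjk
    rcases lt_or_gt_of_ne hjk with h | h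
    · exact key j k h
    · exact (key k j h).symm
  -- `‖U‖ ≥ 2^k m` on the `k`-th copy
  have hUB : ∀ k, ∀ x ∈ B k, (2 : ℝ) ^ k * m ≤ ‖U x‖ := by
    intro k x hx
    simp only [hB_def, mem_ball, dist_eq_norm] at hx
    have ha : 0 < ((2 : ℝ) ^ k)⁻¹ := inv_pos.2 (hak0 k)
    have hz : dist ((2 : ℝ) ^ k • x) x₁ < δ := by
      rw [dist_eq_norm, show (2 : ℝ) ^ k • x - x₁ = (2 : ℝ) ^ k • (x - ((2 : ℝ) ^ k)⁻¹ • x₁) by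
        rw [smul_sub, smul_smul, mul_inv_cancel₀ (hak0 k).ne', one_smul], norm_smul,
        Real.norm_of_nonneg (hak0 k).le]
      calc (2 : ℝ) ^ k * ‖x - ((2 : ℝ) ^ k)⁻¹ • x₁‖
          < (2 : ℝ) ^ k * (((2 : ℝ) ^ k)⁻¹ * δ') := mul_lt_mul_of_pos_left hx (hak0 k)
        _ = δ' := by rw [← mul_assoc, mul_inv_cancel₀ (hak0 k).ne', one_mul]
        _ ≤ δ := hδ'δ
    have h1 := hlow _ hz
    rw [hhom _ (hak0 k) x, norm_smul, Real.norm_of_nonneg ha.le] at h1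
    calc (2 : ℝ) ^ k * m ≤ (2 : ℝ) ^ k * (((2 : ℝ) ^ k)⁻¹ * ‖U x‖) :=
          mul_le_mul_of_nonneg_left h1 (hak0 k).le
      _ = ‖U x‖ := by rw [← mul_assoc, mul_inv_cancel₀ (hak0 k).ne', one_mul]
  -- each copy contributes at least `ε > 0`
  set V : ℝ≥0∞ := volume (ball (0 : EuclideanSpace ℝ (Fin 3)) 1)
  have hV : V ≠ 0 := (measure_ball_pos volume (0 : EuclideanSpace ℝ (Fin 3)) one_pos).ne'
  set ε : ℝ≥0∞ := ENNReal.ofReal (m ^ q * δ' ^ 3) * V with hε_def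
  have hε : ε ≠ 0 := mul_ne_zero (ENNReal.ofReal_pos.2 (by positivity)).ne' hV
  have hterm : ∀ k, ε ≤ ∫⁻ x in B k, ‖U x‖ₑ ^ q := by
    intro k
    have h1 : ∫⁻ _ in B k, ENNReal.ofReal (((2 : ℝ) ^ k * m) ^ q) ≤ ∫⁻ x in B k, ‖U x‖ₑ ^ q := by
      refine setLIntegral_mono' measurableSet_ball fun x hx => ?_
      rw [← ENNReal.ofReal_rpow_of_nonneg (by positivity) hq0, ← ofReal_norm]
      exact ENNReal.rpow_le_rpow (ENNReal.ofReal_le_ofReal (hUB k x hx)) hq0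
    have hvol : volume (B k) = ENNReal.ofReal ((((2 : ℝ) ^ k)⁻¹ * δ') ^ 3) * V := by
      have h := Measure.addHaar_ball_of_pos (volume : Measure (EuclideanSpace ℝ (Fin 3)))
        (((2 : ℝ) ^ k)⁻¹ • x₁) (mul_pos (inv_pos.2 (hak0 k)) hδ')
      rwa [finrank_euclideanSpace_fin] at h
    rw [setLIntegral_const, hvol, ← mul_assoc, ← ENNReal.ofReal_mul (by positivity)] at h1
    refine le_trans ?_ h1
    rw [hε_def]
    refine mul_le_mul_left (ENNReal.ofReal_le_ofReal ?_) V
    have hA3 : ((2 : ℝ) ^ k) ^ (3 : ℕ) ≤ ((2 : ℝ) ^ k) ^ q := by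
      rw [← Real.rpow_natCast]
      exact Real.rpow_le_rpow_of_exponent_le (hak k) (by exact_mod_cast hq)
    calc m ^ q * δ' ^ 3 ≤ ((2 : ℝ) ^ k) ^ q * (((2 : ℝ) ^ k) ^ 3)⁻¹ * (m ^ q * δ' ^ 3) := by
          apply le_mul_of_one_le_left (by positivity)
          rw [← div_eq_mul_inv, one_le_div (by positivity)]
          exact hA3
      _ = ((2 : ℝ) ^ k * m) ^ q * (((2 : ℝ) ^ k)⁻¹ * δ') ^ 3 := by
          rw [Real.mul_rpow (hak0 k).le hm.le, mul_pow, inv_pow]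
          ring
  -- sum over the disjoint copies
  apply top_unique
  calc (⊤ : ℝ≥0∞) = ∑' _ : ℕ, ε := (ENNReal.tsum_const_eq_top_of_ne_zero hε).symm
    _ ≤ ∑' k, ∫⁻ x in B k, ‖U x‖ₑ ^ q := ENNReal.tsum_le_tsum hterm
    _ = ∫⁻ x in ⋃ k, B k, ‖U x‖ₑ ^ q :=
        (lintegral_iUnion (fun _ => measurableSet_ball) hdisj _).symm
    _ ≤ ∫⁻ x in ball (0 : EuclideanSpace ℝ (Fin 3)) 1, ‖U x‖ₑ ^ q :=
        lintegral_mono_set (iUnion_subset hsub)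

/-- **Type II blow-up, Fatou half** [folklore; Fatou's lemma along the Navier–Stokes
rescalings] (registered stub `landauTail_scaledNorm_tendsto_top_of_three_le` of crux
`LandauTailBlowup`, stmt-NavierStokesRegularity-1944): let `u : ℝ → ℝ³ → ℝ³` be jointly
continuous on `(-1, 0) × ℝ³` and have the pointwise parabolic tail
`√(0 - t) • u t (√(0 - t) • y) → U y` (`t → 0⁻`) for every `y ≠ 0`, where the profile `U` is
continuous off the origin, `(-1)`-homogeneous and not identically zero. Then for every real
`q ≥ 3` the CKN-scaled norms `r^{q-5} ∫∫_{Q_r(0,0)} ‖u‖^q` tend to `∞` as `r → 0⁺` (for `q = 3`: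
Seregin's `C(r) → ∞`, i.e. the blow-up is not of Type I in the `L³` scale-invariant sense).
Proof: by `landauTail_scaled_lintegral_eq_nsRescale` the scaled norm is `∫∫_{Q_1} ‖u_r‖^q`;
along any sequence `r_n → 0⁺` the integrands converge a.e. on `Q_1` to `‖U(y)‖^q`
(`landauTail_nsRescale_tendsto_profile`), whose integral over `Q_1 = (-1,0) × B_1` is `∞`
(`landauTail_lintegral_profile_rpow_eq_top`), so Fatou's lemma forbids a bounded subsequence. -/
theorem landauTail_scaledNorm_tendsto_top_of_three_le : ∀ (u : ℝ → EuclideanSpace ℝ (Fin 3) → EuclideanSpace ℝ (Fin 3)) (U : EuclideanSpace ℝ (Fin 3) → EuclideanSpace ℝ (Fin 3)), ContinuousOn (Function.uncurry u) (Set.Ioo (-1 : ℝ) 0 ×ˢ Set.univ) → ContinuousOn U {0}ᶜ → (∀ c : ℝ, 0 < c → ∀ x : EuclideanSpace ℝ (Fin 3), U (c • x) = c⁻¹ • U x) → (∃ x : EuclideanSpace ℝ (Fin 3), U x ≠ 0) → (∀ y : EuclideanSpace ℝ (Fin 3), y ≠ 0 → Filter.Tendsto (fun t : ℝ => Real.sqrt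 (0 - t) • u t (Real.sqrt (0 - t) • y)) (nhdsWithin 0 (Set.Iio 0)) (nhds (U y))) → ∀ q : ℝ, 3 ≤ q → Filter.Tendsto (fun r : ℝ => ENNReal.ofReal (r ^ (q - 5)) * ∫⁻ z in Literature.Analysis.FluidPDE.parabolicCylinder r ((0 : ℝ), (0 : EuclideanSpace ℝ (Fin 3))), ‖u z.1 z.2‖ₑ ^ q) (nhdsWithin 0 (Set.Ioi 0)) (nhds ⊤) := by
  intro u U hu hU hhom hne htail q hq
  have hq0 : 0 < q := by linarith
  set Q₁ : Set (ℝ × EuclideanSpace ℝ (Fin 3)) :=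
    parabolicCylinder 1 ((0 : ℝ), (0 : EuclideanSpace ℝ (Fin 3))) with hQ₁_def
  -- Step 1: the scaled norms are the norms of the rescalings over `Q₁`
  have hcongr : (fun r : ℝ => ∫⁻ z in Q₁, ‖nsRescale r u z.1 z.2‖ₑ ^ q) =ᶠ[𝓝[>] 0]
      fun r => ENNReal.ofReal (r ^ (q - 5)) *
        ∫⁻ z in parabolicCylinder r ((0 : ℝ), (0 : EuclideanSpace ℝ (Fin 3))),
          ‖u z.1 z.2‖ₑ ^ q := by
    filter_upwards [self_mem_nhdsWithin] with r hr
    exact (landauTail_scaled_lintegral_eq_nsRescale u q hq0 r hr).symm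
  refine Tendsto.congr' hcongr ?_
  -- Step 2: suppose some level `M` is undershot frequently, and extract a sequence
  rw [ENNReal.tendsto_nhds_top_iff_nnreal]
  intro M
  by_contra hcon
  have hfreq : ∃ᶠ r in 𝓝[>] (0 : ℝ), (∫⁻ z in Q₁, ‖nsRescale r u z.1 z.2‖ₑ ^ q) ≤ M := by
    rw [not_eventually] at hcon
    exact hcon.mono fun r hr => not_lt.1 hr
  obtain ⟨rs, hrs, hrs'⟩ := exists_seq_forall_of_frequently
    (hfreq.and_eventually (Ioo_mem_nhdsGT zero_lt_one : Set.Ioo (0 : ℝ) 1 ∈ 𝓝[>] (0 : ℝ)))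
  have hQ₁ : Q₁ = Set.Ioo (-1 : ℝ) 0 ×ˢ ball (0 : EuclideanSpace ℝ (Fin 3)) 1 := by
    ext z
    simp only [hQ₁_def, mem_parabolicCylinder, mem_prod, mem_Ioo, mem_ball]
    norm_num
  have hQ₁m : MeasurableSet Q₁ := (isOpen_parabolicCylinder _ _).measurableSet
  set f : ℕ → ℝ × EuclideanSpace ℝ (Fin 3) → ℝ≥0∞ :=
    fun n z => ‖nsRescale (rs n) u z.1 z.2‖ₑ ^ q
  -- the integrands are a.e.-measurable on `Q₁` (continuity of `u` on `(-1,0) × ℝ³`, `0 < rₙ < 1`)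
  have hfm : ∀ n, AEMeasurable (f n) (volume.restrict Q₁) := by
    intro n
    obtain ⟨hr0, hr1⟩ := (hrs' n).2
    have hφ : Continuous fun z : ℝ × EuclideanSpace ℝ (Fin 3) =>
        ((rs n) ^ 2 * z.1, (rs n) • z.2) := by fun_prop
    have hmaps : MapsTo (fun z : ℝ × EuclideanSpace ℝ (Fin 3) => ((rs n) ^ 2 * z.1, (rs n) • z.2))
        Q₁ (Set.Ioo (-1 : ℝ) 0 ×ˢ univ) := by
      intro z hz
      rw [hQ₁] at hz
      obtain ⟨⟨hz1, hz2⟩, -⟩ := hz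
      refine ⟨⟨?_, mul_neg_of_pos_of_neg (pow_pos hr0 2) hz2⟩, mem_univ _⟩
      show (-1 : ℝ) < (rs n) ^ 2 * z.1
      have hr2 : (rs n) ^ 2 ≤ 1 := pow_le_one₀ hr0.le hr1.le
      nlinarith [mul_nonneg (sub_nonneg.2 hr2) (neg_nonneg.2 hz2.le)]
    have hcont : ContinuousOn (fun z : ℝ × EuclideanSpace ℝ (Fin 3) => nsRescale (rs n) u z.1 z.2)
        Q₁ :=
      ((hu.comp hφ.continuousOn hmaps).const_smul (rs n)).congr fun z _ => rfl
    exact (hcont.aemeasurable hQ₁m).enorm.pow_const q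
  -- Step 3: the pointwise limit is `‖U z.2‖ₑ ^ q` a.e. on `Q₁`
  have hae : ∀ᵐ z ∂(volume : Measure (ℝ × EuclideanSpace ℝ (Fin 3))),
      z ∈ Q₁ → liminf (fun n => f n z) atTop = ‖U z.2‖ₑ ^ q := by
    have hnull : volume {z : ℝ × EuclideanSpace ℝ (Fin 3) | z.2 = 0} = 0 := by
      have e : {z : ℝ × EuclideanSpace ℝ (Fin 3) | z.2 = 0} = univ ×ˢ {0} := by
        ext z
        simp
      rw [e, Measure.volume_eq_prod, Measure.prod_prod, measure_singleton, mul_zero]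
    have hae0 : ∀ᵐ z ∂(volume : Measure (ℝ × EuclideanSpace ℝ (Fin 3))), z.2 ≠ 0 := by
      rw [ae_iff]
      simpa only [not_not] using hnull
    filter_upwards [hae0] with z hz hzQ
    rw [hQ₁] at hzQ
    have ht := ((landauTail_nsRescale_tendsto_profile u U hhom htail z.1 hzQ.1.2 z.2 hz).comp
      hrs).enorm
    exact ((ENNReal.continuous_rpow_const.tendsto _).comp ht).liminf_eq
  -- Step 4: the integral of the limit is infinite
  have hUm : Measurable U := by
    classical
    have h := hU.measurable_piecewise (continuousOn_singleton U 0 |>.mono (by simp))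
      isOpen_compl_singleton.measurableSet
    rwa [piecewise_same] at h
  have hI : ∫⁻ z in Q₁, liminf (fun n => f n z) atTop = ⊤ := by
    rw [setLIntegral_congr_fun_ae hQ₁m hae, hQ₁, Measure.volume_eq_prod,
      setLIntegral_prod (fun z : ℝ × EuclideanSpace ℝ (Fin 3) => ‖U z.2‖ₑ ^ q)
        (by exact ((hUm.comp measurable_snd).enorm.pow_const q).aemeasurable)]
    dsimp only
    rw [landauTail_lintegral_profile_rpow_eq_top U hU hhom hne q hq, setLIntegral_const,
      Real.volume_Ioo]
    norm_num
  -- Step 5: Fatou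
  have hle : (⊤ : ℝ≥0∞) ≤ M :=
    calc (⊤ : ℝ≥0∞) = ∫⁻ z in Q₁, liminf (fun n => f n z) atTop := hI.symm
      _ ≤ liminf (fun n => ∫⁻ z in Q₁, f n z) atTop := lintegral_liminf_le' hfm
      _ ≤ M := liminf_le_of_frequently_le' (Frequently.of_forall fun n => (hrs' n).1)
  exact ENNReal.coe_ne_top (top_le_iff.1 hle)

end Summit.NavierStokesRegularity.NavierStokesRegularity.Theorems
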